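import Literature.MathematicalPhysics.QuantumFieldTheory.Balaban1983to89.B5Ineq137Torus
import Literature.MathematicalPhysics.QuantumFieldTheory.Balaban1983to89.B4Block227

/-!
# (2.37) of Bałaban [4] at `j = 0` ON THE TORUS: the `C^{(0)}` kernel `K0` of (1.136) — the first conjunct of
# `B5Ineq137.Leaf235to237` PROVED for the concrete scalar torus tower

B5 = T. Bałaban, *Propagators and renormalization transformations for lattice gauge theories. I*,
Commun. Math. Phys. **95** (1984) 17–40 [cite: Balaban1984PropagatorsI]; [4] = B4 = T. Bałaban, *Regularity
and decay of lattice Green's functions*, Commun. Math. Phys. **89** (1983) 571–597 [cite: Balaban1983RegularityDecay];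
[1] = B1 = *(Higgs)₂,₃ quantum fields in a finite volume I*, Commun. Math. Phys. **85** (1982) 603–636
[cite: Balaban1982Higgs1].
Cell records: GAPS G-pv07-5 residue (R3) (the located leaf `B5Ineq137.Leaf235to237` of `B5Ineq137Torus`), this
module = node G-pv07-5d (b2b-balaban-pv07-g7), certification C-pv07-25, DIVERGENCE D-pv07.18; v1.2 = DOCFIX only (XREAD C-pv15g5-3 D1 title
line; G-adv9-62 `blockOp` locator → [B1] (2.17) p.610 / (2.30) p.611, renders p008/p009 re-read as images; GAPS
C-pv07-30).  value = kernel certificate for a by-reference step, NOT summit progress.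

## The printed step

* B5 p. 39 [PDF 23]: *"In paper [2] we have proved all the necessary properties of G′, except the second order
  inequalities (1.112), (1.113). Let us prove for example (1.112). We use Lemma 2.4 of that paper and the equality
  (2.34) with □ replaced by the whole torus."*; (1.136) first term: *"(∂_μG′_k∂^*_νf)(x) = Σ_{x′∈T_η} η^d(∂_μG′_k∂^*_ν)
  (x,x′)(f(x′) − f(x)) = η^ε Σ_{x′} C^{(0)}(η^{−1}x, η^{−1}x′)|η^{−1}x − η^{−1}x′|^ε (f(x′) − f(x))/|x′ − x|^ε + …"*;
  p. 40 [PDF 24]: *"and applying the estimates (2.35)–(2.37) of Lemma 2.4 in [2] we obtain … (1.137)"*.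
* B4 p. 582 [PDF 12], Lemma 2.4: *"There exist positive constants c₀, δ₀, and for α < 1, there exists a constant c₁,
  such that … |C^{(j)}(□; y, y′)| ≤ c₀e^{−δ₀|y−y′|}, (2.37) for arbitrary non-negative integer j, arbitrary,
  rectangular parallelepiped □ ⊂ L^{−j}Z^d built of large blocks, and x, x′ ∈ □, y, y′ ∈ □^{(j)} = □∩Z^d."*
* B4 p. 584 [PDF 14]: *"Proof of Lemma 2.4. At first let us notice that the inequality (2.37) concerning C^{(j)}(□)
  is a special case of Proposition 2.3. The proof of this proposition will be given in the next section and is based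
  on Corollary 2.3 only. Thus we can assume that (2.37) is proved."*
* B4 p. 574 [PDF 4], Proposition 2.3 of [1]: *"There exist positive constants δ₀, c₀, γ₀, γ₁ dependent on d and M
  only and such that … γ₀I ≤ Δ^{(k)}(Ω, A) + aL^{−2}P(A) ≤ γ₁I, (1.15) |C^{(k)}_Λ(Ω, A; x,x′)| ≤ c₀ exp(−δ₀|x−x′|),
  x, x′ ∈ Λ. (1.16)"*; same page: *"The fifth section will be devoted to a general theorem concerning operators on the
  unit lattice Z^d. There we have abstracted some basic features of our method and we have proven a theorem which,
  if applied to operators (1.14), gives another proof of Proposition 2.3."*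
* B4 p. 594 [PDF 24], the Theorem of Sect. 5: *"Let Ω ⊂ Z^d and let A be a symmetric operator … there exist positive
  constants γ₀, c₀, δ₀ such that A ≥ γ₀I, |A(x,x′)| ≤ c₀e^{−δ₀|x−x′|}, x, x′ ∈ Ω. (5.6) Then there exist positive
  constants c₁, δ₁ such that … |C_Λ(x,x′)| ≤ c₁e^{−δ₁|x−x′|}, x, x′ ∈ Λ, (5.7)"* — PROVED on tori with an arbitrary
  pseudo-distance in `B4Sect5Torus` (`Hyp56`, `inv_decay`, finite Combes–Thomas; b04 lineage).
* B4 p. 580 [PDF 10], the coercivity mechanism (1.15): *"(2.26) … The operator −Δ^{η,N}_Δ is bounded from below by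
  π² on a subspace of functions on Δ orthogonal to constant functions, which are its eigenvectors corresponding to
  eigenvalue 0. The operator P_k is an orthogonal projection on a subspace of constant functions, thus
  ⟨φ,(−Δ^{η,N}_Δ + a_kP_k)φ⟩ ≥ min{π², a_k}‖φ‖_{L²(Δ)}, (2.27)"* — REPAIRED and proved with the constant `8` in
  place of `π²` in `B4Block227.block227_real` (b04 lineage).

## What this module does

At `j = 0` the operator is `C^{(0),η} = G^η_1 = (−Δ^η + m² + a(Lη)^{−2}Q^*_1Q_1)^{−1}` (B1 (2.30) at k = 0 with
(2.17), `B1RG242Torus.G_one`), in lattice units `G0unit P a msq = (−Δ¹ + ε²m² + aL^{−2}Q^*_1Q_1)^{−1}`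
(`B5Display136Torus.G0unit`), and the kernel of (1.136) is `K0 = ∂¹_μ · G0unit · ∂¹ᵀ_ν` (`B5Display136Torus.K0_eq`).
We PROVE, for Bałaban's concrete scalar torus tower (`B1RG242Torus.tower`, U = 1), for every `a > 0`, `m² ≥ 0`:
* §3 `block_poincare` — the block Poincaré–coercivity inequality ON THE TORUS `T^{(i)}` for `e`-fold blocks:
  `min{8,a}‖f‖² ≤ (L^e)²Σ_μ‖∂¹_μf‖² + a⟨f, Q^*Qf⟩` (transport of `B4Block227.block227_real` along the block charts
  `chart : T^{(i')} × {0,…,L^e−1}^d ≃ T^{(i)}` built from `Site.fibreEquiv`, summed over the blocks; reusable for the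
  `K2` node at every level);
* §4 condition (5.6) for the block operator `A = −Δ¹ + m′ + c·Q^*Q` (`blockOp`) with the SUP TORUS METRIC `T` of
  `B5Ineq137Torus`: symmetry (`blockOp_isSymm`), coercivity `γ‖v‖² ≤ ⟨v,Av⟩` for `γ(L^e)² ≤ min{8, c(L^e)²}`
  (`blockOp_coercive`), kernel bound `|A(x,x′)| ≤ (|m′| + 4d + |c|)e^{R}e^{−|x−x′|}` from the FINITE RANGE
  `max{2, L^e − 1}` (`blockOp_decay`); hence (5.7): `|A⁻¹(x,x′)| ≤ (2/γ)e^{−δ₁|x−x′|}` by `B4Sect5Torus.inv_decay`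
  with the lattice profile `K_d` (`rowSum_T_le`) — `blockOp_inv_decay`;
* §5 `G0unit_decay`: `|C^{(0)}(x,x′)| ≤ (2/γ₀)e^{−δ₁|x−x′|}` with `γ₀ = min{8,a}/L²` (`gamma0`), `c₀ = (m² + 4d + a)
  e^{L+1}` (`c0`), `δ₁ = rate K_d γ₀ c₀ 1` (`dK0`); `K0_decay`: `|K0 μ ν x x′| ≤ cK0·e^{−dK0·T(x,x′)}`,
  `cK0 = 4(2/γ₀)e^{2δ₁}` — the two unit derivatives are mixed second differences (`sandwich_apply`), each shifted
  argument costing `e^{δ₁}` (`near_bound`);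
* §6 **`leafK0_torus` / `leaf235to237_conj1`**: the FIRST CONJUNCT of
  `B5Ineq137.Leaf235to237 (scaleData P S (aux P S cube comp) a m²) P.L c₀ δ₀′` (`leaf235to237_iff`: the leaf IS
  `LeafK0 ∧ LeafK123`, by `Iff.rfl`) with `c₀ = cK0 d L a m²`, `δ₀′ = dK0 d L a m²` — constants depending on
  `d, L, a, m²` ONLY (uniform in the volume `m`, the cutoff `K`, the level `S.k`, the cube relation, the component
  map), using `L^k·distX = T` (definitional unfolding); `leaf235to237_of_K123`: the assembly glue for the later nodes
  (monotonicity in the constants, `leafK0_mono`).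

## Conventions and DIVERGENCE D-pv07.18

(a) TORUS, not parallelepiped: (2.37) is printed for `□ ⊂ L^{−j}Z^d` with Neumann conditions; B5 p. 39 applies
Lemma 2.4 *"with □ replaced by the whole torus"*, which is what is proved here (no boundary, no reflection (2.42)).
(b) Constant `8`, not `π²`, in the block Poincaré inequality (`B4Block227`, whose header records why the printed
(2.27) needs repair); only positivity of the constant matters downstream.  (c) U = 1 (scalar model; residue (R2)).
(d) B4's (2.37) carries no derivatives; in (1.136) the `C^{(0)}` term carries `∂_μ … ∂^*_ν` (absorbed into the
notation *"C^{(0)}(η^{−1}x, η^{−1}x′)"*, `B5Display136Torus.K0`); on the unit lattice the derivatives are differences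
of the decaying kernel at points at sup distance ≤ 1, which keeps the rate and multiplies the constant by `4e^{2δ₁}`
— an [analysis] step, kernel-checked (`sandwich_apply`, `near_bound`, `K0_decay`).  (e) Distances: the sup torus
metric `T` in lattice units (D-pv07.17 (a)); `L^{S.k}·distX = T`.  (f) The proof of (5.7) is `B4Sect5Torus`'s finite
Combes–Thomas argument, not the generalized random walk of B4 Sect. 5; constants are explicit, not optimised, and
`m² = 0` is allowed (coercivity comes from `aQ^*Q` and the Poincaré inequality, as in (2.27)/(1.15)).
(g) `lvl 1 ∈ {0,1}`: the degenerate tower `m + K = 0` is covered (`gamma0_le`).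

## What is NOT proved here (located, unchanged)

The conjuncts `K1`, `K3` ((2.35) with/without the derivative, via the b04 torus engines `B4TorusKernel` /
`B4TorusPositivity`) and `K2` ((2.37) at the levels `1 ≤ j < k`, where `Δ^{(j)}` is the variational operator of
B1 (2.20); coercivity again by `block_poincare`) of `Leaf235to237` — nodes G-pv07-5e/5f; the link residue (R-link)
and U ≠ 1 (R2) as recorded in `B5Ineq137Torus`.  No cited fact is introduced: every `[cite:]` tag documents the
provenance of a reading; all theorems are kernel-proved, elementary finite algebra on top of `B4Block227`,
`B4Sect5Torus`, `B1RG242Torus`, `B5Display136Torus`, `B5Ineq137Torus`.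

Version log: v1 (p181774, f944672c88ed) — 2026-08-19, planner-b2b-balaban-pv07-g7-0; v1.1 (this file) — DOCFIX, docstrings
only: in the B4 p. 574 quote above, (1.15) reads «Δ^{(k)}(Ω, A) + aL^{−2}P(A)» and (1.16) «C^{(k)}_Λ(Ω, A; x, x′)»
(A = the background gauge field, Λ = the region; v1 had transcribed «(Ω,Λ)», «P(Λ)» — XREAD C-ref6-87 advisory A1,
render p004-x2 re-read as image); immaterial to the Lean (U = 1, A = 0, P typed as Q^*Q).
-/

namespace Literature.MathematicalPhysics.QuantumFieldTheory.Balaban1983to89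

namespace B5Leaf237C0Torus

open Matrix B1RG242Torus B5Display136Torus B5Ineq137Torus
open Beta.CoordCubePoincare (stepUp)

noncomputable section

/-! ## §1 Two elementary facts about exponential kernel bounds on a finite index set -/

section Abstract

variable {n : Type*}

/-- A kernel of FINITE RANGE `R` for a nonnegative "distance" `ρ` and with bounded entries has exponential decay at
any rate `δ ≥ 0` with the constant `B·e^{δR}`. [folklore] -/
theorem finiteRange_decay {ρ : n → n → ℝ} {M : n → n → ℝ} {B R δ : ℝ} (hδ : 0 ≤ δ)
    (hB : ∀ p q, |M p q| ≤ B) (hR : ∀ p q, M p q ≠ 0 → ρ p q ≤ R) (p q : n) :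
    |M p q| ≤ B * Real.exp (δ * R) * Real.exp (-(δ * ρ p q)) := by
  have hB0 : 0 ≤ B := (abs_nonneg _).trans (hB p q)
  by_cases h0 : M p q = 0
  · rw [h0, abs_zero]; positivity
  · have h1 : (1 : ℝ) ≤ Real.exp (δ * R) * Real.exp (-(δ * ρ p q)) := by
      rw [← Real.exp_add]
      exact Real.one_le_exp (by nlinarith [hR p q h0])
    calc |M p q| ≤ B := hB p q
      _ = B * 1 := (mul_one B).symm
      _ ≤ B * (Real.exp (δ * R) * Real.exp (-(δ * ρ p q))) := mul_le_mul_of_nonneg_left h1 hB0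
      _ = B * Real.exp (δ * R) * Real.exp (-(δ * ρ p q)) := by ring

/-- Exponential bounds are MONOTONE in the constants: a bound with `(c, δ)` implies the bound with any `c′ ≥ c` and
any rate `δ′ ≤ δ` (nonnegative distance). [folklore] -/
theorem decay_mono {t c c' δ δ' v : ℝ} (ht : 0 ≤ t) (hc : c ≤ c') (hc0 : 0 ≤ c) (hδ : δ' ≤ δ)
    (h : v ≤ c * Real.exp (-(δ * t))) : v ≤ c' * Real.exp (-(δ' * t)) := by
  have h1 : Real.exp (-(δ * t)) ≤ Real.exp (-(δ' * t)) := Real.exp_le_exp.mpr (by nlinarith)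
  calc v ≤ c * Real.exp (-(δ * t)) := h
    _ ≤ c * Real.exp (-(δ' * t)) := mul_le_mul_of_nonneg_left h1 hc0
    _ ≤ c' * Real.exp (-(δ' * t)) := mul_le_mul_of_nonneg_right hc (Real.exp_pos _).le

end Abstract

/-! ## §2 The sup torus metric `T` of `Site P i`: unit shifts move by at most one, blocks have diameter `< L^e` -/

section Metric

variable (P : Params) {i i' e : ℕ}

/-- A unit shift moves a site by at most `1` in the sup torus metric. [folklore] -/
theorem T_shift_le_one (x : Site P i) (μ : Fin P.d) : T P i x (Site.shift x μ) ≤ 1 := by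
  unfold T B4Sect5Torus.tdist
  have h : Finset.univ.sup (B4Sect5Torus.ccoord (Nv P i) (toT x) (toT (Site.shift x μ))) ≤ 1 := by
    apply Finset.sup_le
    intro ν _
    apply Int.toNat_le.mpr
    show B4TorusKernel.MultiPeriod.circAbs (Nv P i ν) ((((toT x) ν).val : ℤ) - (((toT (Site.shift x μ)) ν).val : ℤ))
      ≤ ((1 : ℕ) : ℤ)
    have ex : ((toT x) ν).val = (x ν).val := rfl
    have es : ((toT (Site.shift x μ)) ν).val = (Site.shift x μ ν).val := rfl
    rw [ex, es]
    by_cases hν : ν = μ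
    · subst hν
      have hs : Site.shift x ν ν = x ν + 1 := by simp [Site.shift]
      rw [hs, ZMod.val_add, ZMod.val_one]
      have hNv : Nv P i ν = P.sitesPerDir i := rfl
      rw [hNv]
      have hdm := Nat.div_add_mod ((x ν).val + 1) (P.sitesPerDir i)
      generalize ((x ν).val + 1) / P.sitesPerDir i = q at hdm
      generalize ((x ν).val + 1) % P.sitesPerDir i = r at hdm ⊢
      have hq : ((x ν).val : ℤ) - (r : ℤ) = -1 + (P.sitesPerDir i : ℤ) * (q : ℤ) := by
        have h' : ((P.sitesPerDir i * q + r : ℕ) : ℤ) = (((x ν).val + 1 : ℕ) : ℤ) := by rw [hdm]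
        push_cast at h'
        linarith
      rw [hq, B4TorusKernel.MultiPeriod.circAbs_add_mul]
      have := B4TorusKernel.MultiPeriod.circAbs_le_abs (N := P.sitesPerDir i) (P.one_lt_sitesPerDir i).le (-1)
      simpa using this
    · have hs : Site.shift x μ ν = x ν := by simp [Site.shift, Function.update_of_ne hν]
      rw [hs, sub_self, B4Sect5Torus.circAbs_zero]
      norm_num
  exact_mod_cast h

/-- Two sites of the same `L^e`-block are at sup distance `≤ L^e − 1`. [folklore] -/
theorem T_le_of_proj_eq (h : P.sitesPerDir i = P.L ^ e * P.sitesPerDir i') {x x' : Site P i}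
    (hxx : Site.proj i' e x = Site.proj i' e x') : T P i x x' ≤ (P.L : ℝ) ^ e - 1 := by
  unfold T B4Sect5Torus.tdist
  have hL1 : 1 ≤ P.L ^ e := Nat.one_le_pow _ _ P.L_pos
  have hsup : Finset.univ.sup (B4Sect5Torus.ccoord (Nv P i) (toT x) (toT x')) ≤ P.L ^ e - 1 := by
    apply Finset.sup_le
    intro ν _
    apply Int.toNat_le.mpr
    have ex : ((toT x) ν).val = (x ν).val := rfl
    have ex' : ((toT x') ν).val = (x' ν).val := rfl
    rw [ex, ex']
    have hq : (x ν).val / P.L ^ e = (x' ν).val / P.L ^ e := by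
      rw [← Site.val_proj h x ν, ← Site.val_proj h x' ν, hxx]
    have h1 := Nat.div_add_mod (x ν).val (P.L ^ e)
    have h2 := Nat.div_add_mod (x' ν).val (P.L ^ e)
    have hm1 : (x ν).val % P.L ^ e < P.L ^ e := Nat.mod_lt _ (pow_pos P.L_pos e)
    have hm2 : (x' ν).val % P.L ^ e < P.L ^ e := Nat.mod_lt _ (pow_pos P.L_pos e)
    rw [hq] at h1
    generalize (x' ν).val / P.L ^ e = q at h1 h2
    generalize (x ν).val % P.L ^ e = r₁ at h1 hm1
    generalize (x' ν).val % P.L ^ e = r₂ at h2 hm2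
    have hab : |((x ν).val : ℤ) - ((x' ν).val : ℤ)| ≤ ((P.L ^ e - 1 : ℕ) : ℤ) := by
      rw [abs_le, ← h1, ← h2, Nat.cast_sub hL1]
      push_cast
      constructor <;> nlinarith
    exact (B4TorusKernel.MultiPeriod.circAbs_le_abs (Nv_pos P i ν) _).trans hab
  calc ((Finset.univ.sup (B4Sect5Torus.ccoord (Nv P i) (toT x) (toT x')) : ℕ) : ℝ)
      ≤ ((P.L ^ e - 1 : ℕ) : ℝ) := by exact_mod_cast hsup
    _ = (P.L : ℝ) ^ e - 1 := by rw [Nat.cast_sub hL1]; push_cast; ring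

/-- `T` is a pseudo-distance in the sense of `B4Sect5Torus`. [folklore] -/
theorem T_isPseudoDist (i : ℕ) : B4Sect5Torus.IsPseudoDist (T P i) :=
  ⟨T_symm P i, T_self P i, T_triangle P i⟩

/-- Row sums of `e^{−aT}` are bounded by the lattice profile `K_d(a)` (`rowSum_T_le`), i.e. `SumBound`. [folklore] -/
theorem T_sumBound (i : ℕ) : B4Sect5Torus.SumBound (T P i) (B4Sect5Proof.latticeConst P.d) :=
  fun _ ha x => rowSum_T_le P i ha x

end Metric

/-! ## §3 Blocks as charts: `T^{(i')} × {0,…,L^e−1}^d ≃ T^{(i)}` and the block Poincaré inequality (2.27) on the torus -/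

section Block

variable (P : Params) {i i' e n : ℕ}

/-- The fibre chart of the `e`-fold block map: (block label `y`, in-block offset `r`) ↦ the fine site with label
`y·L^e + r` coordinatewise (`Site.fibreSite`); a bijection when `sitesPerDir i = L^e · sitesPerDir i'`. [folklore] -/
def chart (h : P.sitesPerDir i = P.L ^ e * P.sitesPerDir i') :
    Site P i' × (Fin P.d → Fin (P.L ^ e)) ≃ Site P i :=
  ((Equiv.sigmaFiberEquiv (fun x : Site P i => Site.proj i' e x)).symm.trans
    ((Equiv.sigmaCongrRight fun y => Site.fibreEquiv h y).trans
      (Equiv.sigmaEquivProd (Site P i') (Fin P.d → Fin (P.L ^ e))))).symm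

/-- The chart is `fibreSite`. [folklore] -/
theorem chart_apply (h : P.sitesPerDir i = P.L ^ e * P.sitesPerDir i') (y : Site P i')
    (r : Fin P.d → Fin (P.L ^ e)) : chart P h (y, r) = Site.fibreSite i e y r := rfl

/-- Sums over the fine torus = sums over blocks of sums over offsets. [folklore] -/
theorem sum_chart (h : P.sitesPerDir i = P.L ^ e * P.sitesPerDir i') (F : Site P i → ℝ) :
    ∑ x, F x = ∑ y : Site P i', ∑ r : Fin P.d → Fin (P.L ^ e), F (Site.fibreSite i e y r) := by
  rw [← (chart P h).sum_comp F, Fintype.sum_prod_type]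
  rfl

/-- The site of block `y` with offset `r` read in `Fin (n+1)`, `n + 1 = L^e` (the cube type of `B4Block227`).
[folklore] -/
def bsite (i e : ℕ) (hn : n + 1 = P.L ^ e) (y : Site P i') (r : Fin P.d → Fin (n + 1)) : Site P i :=
  Site.fibreSite i e y (fun μ => Fin.cast hn (r μ))

/-- Sums over the fine torus through `bsite`. [folklore] -/
theorem sum_bsite (h : P.sitesPerDir i = P.L ^ e * P.sitesPerDir i') (hn : n + 1 = P.L ^ e) (F : Site P i → ℝ) :
    ∑ x, F x = ∑ y : Site P i', ∑ r : Fin P.d → Fin (n + 1), F (bsite P i e hn y r) := by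
  rw [sum_chart P h]
  refine Finset.sum_congr rfl fun y _ => ?_
  exact ((Equiv.piCongrRight fun _ : Fin P.d => finCongr hn).sum_comp
    (fun r : Fin P.d → Fin (P.L ^ e) => F (Site.fibreSite i e y r))).symm

/-- `bsite y r` lies in block `y`. [folklore] -/
theorem proj_bsite (h : P.sitesPerDir i = P.L ^ e * P.sitesPerDir i') (hn : n + 1 = P.L ^ e) (y : Site P i')
    (r : Fin P.d → Fin (n + 1)) : Site.proj i' e (bsite P i e hn y r) = y :=
  Site.proj_fibreSite h y _

/-- Inside a block, increasing the offset by one in direction `μ` is the unit shift of the torus. [folklore] -/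
theorem bsite_stepUp (hn : n + 1 = P.L ^ e) (y : Site P i') (r : Fin P.d → Fin (n + 1)) (μ : Fin P.d)
    (hr : r μ ≠ Fin.last n) : bsite P i e hn y (stepUp r μ) = Site.shift (bsite P i e hn y r) μ := by
  funext ν
  simp only [bsite, Site.fibreSite, Site.shift, stepUp]
  by_cases hν : ν = μ
  · subst hν
    rw [Function.update_self, Function.update_self]
    have h1 : ((r ν + 1 : Fin (n + 1)) : ℕ) = (r ν : ℕ) + 1 :=
      Fin.val_add_one_of_lt (Fin.lt_last_iff_ne_last.mpr hr)
    simp only [Fin.val_cast, h1]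
    push_cast
    ring
  · rw [Function.update_of_ne hν, Function.update_of_ne hν]
    rfl

/-- **Block Poincaré–coercivity on the torus** ((2.27) of [B4] repaired, = `B4Block227.block227_real` transported
along the block charts and summed over the blocks): for every real `f` on `T^{(i)}` and every real `a`,
`min{8,a}·Σ_x f(x)² ≤ (L^e)²·Σ_μ‖∂¹_μ f‖² + a·⟨f, Q^*Q f⟩`, where `Q` = the `e`-fold block average with weight
`L^{−ed}` and `Q^*` the piecewise-constant extension (only the intra-block bonds are needed on the right; we keep
all bonds, which only increases it).  Constant `8` (not `π²`): see `B4Block227`. [folklore] -/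
theorem block_poincare (h : P.sitesPerDir i = P.L ^ e * P.sitesPerDir i') (a : ℝ) (f : Site P i → ℝ) :
    min 8 a * (f ⬝ᵥ f) ≤ ((P.L : ℝ) ^ e) ^ 2 * ∑ μ, (deriv P i 1 μ *ᵥ f) ⬝ᵥ (deriv P i 1 μ *ᵥ f)
      + a * (f ⬝ᵥ ((extMat P i i' e * avgMat P i i' e ((((P.L : ℝ) ^ P.d)⁻¹) ^ e)) *ᵥ f)) := by
  obtain ⟨n, hn⟩ : ∃ n, n + 1 = P.L ^ e := ⟨P.L ^ e - 1, Nat.sub_add_cancel (Nat.one_le_pow _ _ P.L_pos)⟩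
  have hLe : ((P.L : ℝ) ^ e) = (n : ℝ) + 1 := by exact_mod_cast hn.symm
  set w : ℝ := (((P.L : ℝ) ^ P.d)⁻¹) ^ e with hw
  have hw' : w = (((n : ℝ) + 1) ^ P.d)⁻¹ := by
    rw [hw, ← hLe, ← inv_pow, ← pow_mul, ← pow_mul, mul_comm, inv_pow]
  have hp : ∀ (y : Site P i') (r : Fin P.d → Fin (n + 1)), Site.proj i' e (bsite P i e hn y r) = y :=
    fun y r => proj_bsite P h hn y r
  -- (1) the left-hand side through the charts
  have h1 : f ⬝ᵥ f = ∑ y : Site P i', ∑ r : Fin P.d → Fin (n + 1), f (bsite P i e hn y r) ^ 2 := by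
    rw [dotProduct, sum_bsite P h hn]
    simp only [sq]
  -- (2) the intra-block bonds are among all bonds
  have h2 : ∀ μ : Fin P.d,
      ∑ y : Site P i', ∑ r ∈ Finset.univ.filter (fun r : Fin P.d → Fin (n + 1) => r μ ≠ Fin.last n),
          (f (bsite P i e hn y (stepUp r μ)) - f (bsite P i e hn y r)) ^ 2
        ≤ (deriv P i 1 μ *ᵥ f) ⬝ᵥ (deriv P i 1 μ *ᵥ f) := by
    intro μ
    have hd : (deriv P i 1 μ *ᵥ f) ⬝ᵥ (deriv P i 1 μ *ᵥ f) = ∑ x, (f (Site.shift x μ) - f x) ^ 2 := by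
      simp only [dotProduct, deriv_mulVec, inv_one, one_mul, sq]
    rw [hd, sum_bsite P h hn]
    refine Finset.sum_le_sum fun y _ => ?_
    calc ∑ r ∈ Finset.univ.filter (fun r : Fin P.d → Fin (n + 1) => r μ ≠ Fin.last n),
            (f (bsite P i e hn y (stepUp r μ)) - f (bsite P i e hn y r)) ^ 2
        = ∑ r ∈ Finset.univ.filter (fun r : Fin P.d → Fin (n + 1) => r μ ≠ Fin.last n),
            (f (Site.shift (bsite P i e hn y r) μ) - f (bsite P i e hn y r)) ^ 2 := by
          refine Finset.sum_congr rfl fun r hr => ?_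
          rw [bsite_stepUp P hn y r μ (Finset.mem_filter.mp hr).2]
      _ ≤ ∑ r, (f (Site.shift (bsite P i e hn y r) μ) - f (bsite P i e hn y r)) ^ 2 :=
          Finset.sum_le_sum_of_subset_of_nonneg (Finset.filter_subset _ _) fun r _ _ => sq_nonneg _
  -- (3) the block-average term through the charts
  have hA : ∀ y : Site P i', (avgMat P i i' e w *ᵥ f) y = w * ∑ r : Fin P.d → Fin (n + 1), f (bsite P i e hn y r) := by
    intro y
    rw [avgMat_mulVec, sum_bsite P h hn, Finset.mul_sum, Finset.sum_eq_single y]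
    · refine Finset.sum_congr rfl fun r _ => ?_
      rw [if_pos (hp y r)]
    · intro y' _ hy'
      refine Finset.sum_eq_zero fun r _ => ?_
      rw [if_neg]
      rw [hp y' r]
      exact hy'
    · intro hy
      exact absurd (Finset.mem_univ y) hy
  have h3 : f ⬝ᵥ ((extMat P i i' e * avgMat P i i' e w) *ᵥ f)
      = ∑ y : Site P i', w * (∑ r : Fin P.d → Fin (n + 1), f (bsite P i e hn y r)) ^ 2 := by
    rw [← Matrix.mulVec_mulVec, dotProduct_extMat_mulVec, sum_bsite P h hn]
    refine Finset.sum_congr rfl fun y _ => ?_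
    simp_rw [hp]
    rw [hA y, ← Finset.sum_mul, sq]
    ring
  -- (4) the block inequalities, summed over the blocks
  have hB : ∀ y : Site P i', min 8 a * ∑ r : Fin P.d → Fin (n + 1), f (bsite P i e hn y r) ^ 2
      ≤ ((P.L : ℝ) ^ e) ^ 2 * ∑ μ : Fin P.d,
            ∑ r ∈ Finset.univ.filter (fun r : Fin P.d → Fin (n + 1) => r μ ≠ Fin.last n),
              (f (bsite P i e hn y (stepUp r μ)) - f (bsite P i e hn y r)) ^ 2
        + a * (w * (∑ r, f (bsite P i e hn y r)) ^ 2) := by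
    intro y
    have := B4Block227.block227_real n P.d a (fun r => f (bsite P i e hn y r))
    rw [hLe, hw', ← mul_assoc]
    exact this
  have hD := Finset.sum_le_sum fun μ (_ : μ ∈ (Finset.univ : Finset (Fin P.d))) => h2 μ
  have hL2 : (0 : ℝ) ≤ ((P.L : ℝ) ^ e) ^ 2 := sq_nonneg _
  calc min 8 a * (f ⬝ᵥ f)
      = ∑ y : Site P i', min 8 a * ∑ r : Fin P.d → Fin (n + 1), f (bsite P i e hn y r) ^ 2 := by
        rw [h1, Finset.mul_sum]
    _ ≤ ∑ y : Site P i', (((P.L : ℝ) ^ e) ^ 2 * ∑ μ : Fin P.d,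
            ∑ r ∈ Finset.univ.filter (fun r : Fin P.d → Fin (n + 1) => r μ ≠ Fin.last n),
              (f (bsite P i e hn y (stepUp r μ)) - f (bsite P i e hn y r)) ^ 2
          + a * (w * (∑ r, f (bsite P i e hn y r)) ^ 2)) := Finset.sum_le_sum fun y _ => hB y
    _ = ((P.L : ℝ) ^ e) ^ 2 * ∑ μ : Fin P.d, ∑ y : Site P i',
            ∑ r ∈ Finset.univ.filter (fun r : Fin P.d → Fin (n + 1) => r μ ≠ Fin.last n),
              (f (bsite P i e hn y (stepUp r μ)) - f (bsite P i e hn y r)) ^ 2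
          + a * ∑ y : Site P i', w * (∑ r, f (bsite P i e hn y r)) ^ 2 := by
        rw [Finset.sum_add_distrib, ← Finset.mul_sum, ← Finset.mul_sum, Finset.sum_comm]
    _ ≤ ((P.L : ℝ) ^ e) ^ 2 * ∑ μ, (deriv P i 1 μ *ᵥ f) ⬝ᵥ (deriv P i 1 μ *ᵥ f)
          + a * (f ⬝ᵥ ((extMat P i i' e * avgMat P i i' e w) *ᵥ f)) := by
        rw [h3]
        have := mul_le_mul_of_nonneg_left hD hL2
        linarith

end Block

/-! ## §4 The block operator `−Δ¹ + m′ + c·Q^*Q` on `T^{(i)}`: condition (5.6) of [B4] and the decay of its inverse -/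

section BlockOp

variable (P : Params) {i i' e : ℕ}

/-- `A = −Δ¹ + m′ + c·Q^*Q` on `T^{(i)}` (unit spacing; `Q` = the `e`-fold block average to `T^{(i')}` with weight
`L^{−ed}`, `Q^*` = the piecewise-constant extension): the operator inverted in (2.30) of [B1] at `k = 0` with (2.17)
(`C^{(0),ε}(Ω,A) = (a(Lε)^{−2}P(A) + Δ^{(0),ε}(Ω,A))^{−1}`, `Δ^{(0),ε}(Ω,A) = −Δ^{ε,N}_{A,Ω} + m²`), at one level, in
lattice units, `U = 1`, `Ω` = the torus.  For `i = 0, i' = 1, e = lvl 1, m′ = ε²m², c = aL^{−2}` its inverse is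
`G0unit` (`G0unit_eq`). [cite: Balaban1982Higgs1, (2.17) p.610, (2.30) p.611; dictionary] -/
def blockOp (i i' e : ℕ) (m' c : ℝ) : Matrix (Site P i) (Site P i) ℝ :=
  hOp P i 1 m' + c • (extMat P i i' e * avgMat P i i' e ((((P.L : ℝ) ^ P.d)⁻¹) ^ e))

/-- The averaging weight `L^{−ed} ∈ [0,1]`. [folklore] -/
theorem weight_nonneg_le_one (e : ℕ) :
    0 ≤ (((P.L : ℝ) ^ P.d)⁻¹) ^ e ∧ (((P.L : ℝ) ^ P.d)⁻¹) ^ e ≤ 1 := by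
  have hL : (1 : ℝ) ≤ (P.L : ℝ) ^ P.d := one_le_pow₀ (one_lt_cast_L P).le
  have h0 : (0 : ℝ) ≤ ((P.L : ℝ) ^ P.d)⁻¹ := inv_nonneg.mpr (by positivity)
  exact ⟨pow_nonneg h0 _, pow_le_one₀ h0 (inv_le_one_of_one_le₀ hL)⟩

/-- The kernel of `Q^*Q`: `w` on pairs in a common block, `0` otherwise. [folklore] -/
theorem EA_apply (w : ℝ) (x x' : Site P i) :
    (extMat P i i' e * avgMat P i i' e w) x x' = if Site.proj i' e x' = Site.proj i' e x then w else 0 := by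
  rw [Matrix.mul_apply]
  simp only [extMat, avgMat, ite_mul, one_mul, zero_mul]
  rw [Finset.sum_ite_eq, if_pos (Finset.mem_univ _)]

/-- The kernel of `∂¹_μ`: `∂(z,x) = [x = z + e_μ] − [x = z]`. [folklore] -/
theorem deriv_one_apply (μ : Fin P.d) (z x : Site P i) :
    deriv P i 1 μ z x = (if x = Site.shift z μ then 1 else 0) - (if z = x then 1 else 0) := by
  simp only [B1RG242Torus.deriv, shiftMat, inv_one, one_smul, Matrix.sub_apply, Matrix.one_apply]

/-- `|∂(z,x)| ≤ 2`. [folklore] -/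
theorem abs_deriv_one_le (μ : Fin P.d) (z x : Site P i) : |deriv P i 1 μ z x| ≤ 2 := by
  rw [deriv_one_apply]
  split_ifs <;> norm_num

/-- The columns of `∂¹_μ` have ℓ¹ norm `≤ 2`. [folklore] -/
theorem sum_abs_deriv_one_le (μ : Fin P.d) (x : Site P i) : ∑ z, |deriv P i 1 μ z x| ≤ 2 := by
  have h1 : ∀ z, |deriv P i 1 μ z x|
      ≤ (if z = Site.unshift x μ then (1 : ℝ) else 0) + (if z = x then 1 else 0) := by
    intro z
    rw [deriv_one_apply]
    simp_rw [eq_shift_iff x z μ]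
    split_ifs <;> norm_num
  calc ∑ z, |deriv P i 1 μ z x|
      ≤ ∑ z, ((if z = Site.unshift x μ then (1 : ℝ) else 0) + (if z = x then 1 else 0)) :=
        Finset.sum_le_sum fun z _ => h1 z
    _ = 2 := by
        rw [Finset.sum_add_distrib, Finset.sum_ite_eq', Finset.sum_ite_eq', if_pos (Finset.mem_univ _),
          if_pos (Finset.mem_univ _)]
        norm_num

/-- `|(∂ᵀ_μ∂_μ)(x,x′)| ≤ 4`. [folklore] -/
theorem abs_dd_apply_le (μ : Fin P.d) (x x' : Site P i) : |((deriv P i 1 μ)ᵀ * deriv P i 1 μ) x x'| ≤ 4 := by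
  rw [Matrix.mul_apply]
  simp only [Matrix.transpose_apply]
  calc |∑ z, deriv P i 1 μ z x * deriv P i 1 μ z x'|
      ≤ ∑ z, |deriv P i 1 μ z x * deriv P i 1 μ z x'| := Finset.abs_sum_le_sum_abs _ _
    _ = ∑ z, |deriv P i 1 μ z x| * |deriv P i 1 μ z x'| := by simp_rw [abs_mul]
    _ ≤ ∑ z, |deriv P i 1 μ z x| * 2 :=
        Finset.sum_le_sum fun z _ => mul_le_mul_of_nonneg_left (abs_deriv_one_le P μ z x') (abs_nonneg _)
    _ ≤ 4 := by rw [← Finset.sum_mul]; linarith [sum_abs_deriv_one_le P μ x]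

/-- The kernel of `−Δ¹ + m′`. [folklore] -/
theorem hOp_one_apply (m' : ℝ) (x x' : Site P i) :
    hOp P i 1 m' x x' = m' * (if x = x' then 1 else 0) + ∑ μ, ((deriv P i 1 μ)ᵀ * deriv P i 1 μ) x x' := by
  simp only [hOp, Matrix.add_apply, Matrix.smul_apply, Matrix.one_apply, smul_eq_mul, Matrix.sum_apply]

/-- `|(−Δ¹ + m′)(x,x′)| ≤ |m′| + 4d`. [folklore] -/
theorem abs_hOp_one_apply_le (m' : ℝ) (x x' : Site P i) : |hOp P i 1 m' x x'| ≤ |m'| + 4 * P.d := by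
  rw [hOp_one_apply]
  have hm : |m' * (if x = x' then (1 : ℝ) else 0)| ≤ |m'| := by
    split_ifs
    · rw [mul_one]
    · rw [mul_zero, abs_zero]; exact abs_nonneg _
  have hs : |∑ μ, ((deriv P i 1 μ)ᵀ * deriv P i 1 μ) x x'| ≤ 4 * P.d :=
    calc |∑ μ, ((deriv P i 1 μ)ᵀ * deriv P i 1 μ) x x'|
        ≤ ∑ μ, |((deriv P i 1 μ)ᵀ * deriv P i 1 μ) x x'| := Finset.abs_sum_le_sum_abs _ _
      _ ≤ ∑ _μ : Fin P.d, (4 : ℝ) := Finset.sum_le_sum fun μ _ => abs_dd_apply_le P μ x x'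
      _ = 4 * P.d := by
          rw [Finset.sum_const, Finset.card_univ, Fintype.card_fin, nsmul_eq_mul]; ring
  exact (abs_add_le _ _).trans (add_le_add hm hs)

/-- `(∂ᵀ_μ∂_μ)(x,x′) ≠ 0 ⇒ |x − x′| ≤ 2` (nearest and next-nearest neighbours only). [folklore] -/
theorem T_le_two_of_dd_ne_zero (μ : Fin P.d) {x x' : Site P i}
    (h : ((deriv P i 1 μ)ᵀ * deriv P i 1 μ) x x' ≠ 0) : T P i x x' ≤ 2 := by
  rw [Matrix.mul_apply] at h
  obtain ⟨z, _, hz⟩ := Finset.exists_ne_zero_of_sum_ne_zero h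
  simp only [Matrix.transpose_apply] at hz
  have near : ∀ {u : Site P i}, deriv P i 1 μ z u ≠ 0 → T P i z u ≤ 1 := by
    intro u hu
    rw [deriv_one_apply] at hu
    by_cases ha : u = Site.shift z μ
    · rw [ha]; exact T_shift_le_one P z μ
    · by_cases hb : z = u
      · rw [hb, T_self]; norm_num
      · rw [if_neg ha, if_neg hb, sub_zero] at hu; exact absurd rfl hu
  calc T P i x x' ≤ T P i x z + T P i z x' := T_triangle P i x z x'
    _ ≤ 1 + 1 := add_le_add (by rw [T_symm]; exact near (left_ne_zero_of_mul hz)) (near (right_ne_zero_of_mul hz))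
    _ = 2 := by norm_num

/-- `(−Δ¹ + m′)(x,x′) ≠ 0 ⇒ |x − x′| ≤ 2`. [folklore] -/
theorem T_le_two_of_hOp_ne_zero (m' : ℝ) {x x' : Site P i} (h : hOp P i 1 m' x x' ≠ 0) : T P i x x' ≤ 2 := by
  rw [hOp_one_apply] at h
  by_cases hx : x = x'
  · rw [hx, T_self]; norm_num
  · rw [if_neg hx, mul_zero, zero_add] at h
    obtain ⟨μ, _, hμ⟩ := Finset.exists_ne_zero_of_sum_ne_zero h
    exact T_le_two_of_dd_ne_zero P μ hμ

/-- `(Q^*Q)(x,x′) ≠ 0 ⇒ |x − x′| ≤ L^e − 1`. [folklore] -/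
theorem T_le_of_EA_ne_zero (hg : P.sitesPerDir i = P.L ^ e * P.sitesPerDir i') (w : ℝ) {x x' : Site P i}
    (h : (extMat P i i' e * avgMat P i i' e w) x x' ≠ 0) : T P i x x' ≤ (P.L : ℝ) ^ e - 1 := by
  rw [EA_apply] at h
  by_cases hq : Site.proj i' e x' = Site.proj i' e x
  · exact T_le_of_proj_eq P hg hq.symm
  · rw [if_neg hq] at h; exact absurd rfl h

variable {P}

/-- `A` is symmetric. [folklore] -/
theorem blockOp_isSymm (i i' e : ℕ) (m' c : ℝ) : (blockOp P i i' e m' c).IsSymm := by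
  have h1 : (hOp P i 1 m').IsSymm := by
    unfold Matrix.IsSymm hOp
    rw [Matrix.transpose_add, Matrix.transpose_smul, Matrix.transpose_one, Matrix.transpose_sum]
    congr 1
    refine Finset.sum_congr rfl fun μ _ => ?_
    rw [Matrix.transpose_mul, Matrix.transpose_transpose]
  have h2 : (extMat P i i' e * avgMat P i i' e ((((P.L : ℝ) ^ P.d)⁻¹) ^ e)).IsSymm := by
    refine Matrix.IsSymm.ext fun x x' => ?_
    rw [EA_apply, EA_apply]
    by_cases hq : Site.proj i' e x' = Site.proj i' e x
    · rw [if_pos hq, if_pos hq.symm]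
    · rw [if_neg hq, if_neg (fun h' => hq h'.symm)]
  exact h1.add (h2.smul c)

/-- ENTRY BOUND: `|A(x,x′)| ≤ |m′| + 4d + |c|`. [folklore] -/
theorem blockOp_apply_bound (m' c : ℝ) (x x' : Site P i) : |blockOp P i i' e m' c x x'| ≤ |m'| + 4 * P.d + |c| := by
  unfold blockOp
  rw [Matrix.add_apply, Matrix.smul_apply, smul_eq_mul]
  have hw := weight_nonneg_le_one P e
  have hE : |c * (extMat P i i' e * avgMat P i i' e ((((P.L : ℝ) ^ P.d)⁻¹) ^ e)) x x'| ≤ |c| := by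
    rw [abs_mul, EA_apply]
    split_ifs
    · calc |c| * |(((P.L : ℝ) ^ P.d)⁻¹) ^ e| ≤ |c| * 1 :=
            mul_le_mul_of_nonneg_left (by rw [abs_of_nonneg hw.1]; exact hw.2) (abs_nonneg c)
        _ = |c| := mul_one _
    · rw [abs_zero, mul_zero]; exact abs_nonneg c
  exact (abs_add_le _ _).trans (add_le_add (abs_hOp_one_apply_le P m' x x') hE)

/-- FINITE RANGE: `A(x,x′) ≠ 0 ⇒ |x − x′| ≤ max{2, L^e − 1}`. [folklore] -/
theorem blockOp_range (hg : P.sitesPerDir i = P.L ^ e * P.sitesPerDir i') (m' c : ℝ) {x x' : Site P i}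
    (h : blockOp P i i' e m' c x x' ≠ 0) : T P i x x' ≤ max 2 ((P.L : ℝ) ^ e - 1) := by
  unfold blockOp at h
  rw [Matrix.add_apply, Matrix.smul_apply, smul_eq_mul] at h
  by_cases h1 : hOp P i 1 m' x x' = 0
  · rw [h1, zero_add] at h
    exact (T_le_of_EA_ne_zero P hg _ (right_ne_zero_of_mul h)).trans (le_max_right _ _)
  · exact (T_le_two_of_hOp_ne_zero P m' h1).trans (le_max_left _ _)

/-- KERNEL BOUND of (5.6): `|A(x,x′)| ≤ B·e^{R}·e^{−|x−x′|}` for any `B ≥ |m′| + 4d + |c|` and any range bound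
`R ≥ max{2, L^e − 1}`. [folklore] -/
theorem blockOp_decay (hg : P.sitesPerDir i = P.L ^ e * P.sitesPerDir i') {m' c B R : ℝ}
    (hB : |m'| + 4 * P.d + |c| ≤ B) (hR2 : 2 ≤ R) (hRe : (P.L : ℝ) ^ e - 1 ≤ R) (x x' : Site P i) :
    |blockOp P i i' e m' c x x'| ≤ B * Real.exp (1 * R) * Real.exp (-(1 * T P i x x')) :=
  finiteRange_decay zero_le_one (fun p q => (blockOp_apply_bound m' c p q).trans hB)
    (fun _ _ hpq => (blockOp_range hg m' c hpq).trans (max_le hR2 hRe)) x x'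

/-- COERCIVITY of (5.6): `γ·‖v‖² ≤ ⟨v, Av⟩` whenever `m′, c ≥ 0` and `γ(L^e)² ≤ min{8, c(L^e)²}` — from the block
Poincaré inequality with `a = c(L^e)²`. [folklore] -/
theorem blockOp_coercive (hg : P.sitesPerDir i = P.L ^ e * P.sitesPerDir i') {m' c γ : ℝ} (hm : 0 ≤ m')
    (hγ : γ * ((P.L : ℝ) ^ e) ^ 2 ≤ min 8 (c * ((P.L : ℝ) ^ e) ^ 2)) (v : Site P i → ℝ) :
    γ * ∑ p, v p ^ 2 ≤ ∑ p, v p * (blockOp P i i' e m' c).mulVec v p := by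
  have hP := block_poincare P hg (c * ((P.L : ℝ) ^ e) ^ 2) v
  have hform : ∑ p, v p * (blockOp P i i' e m' c).mulVec v p
      = m' * (v ⬝ᵥ v) + ∑ μ, (deriv P i 1 μ *ᵥ v) ⬝ᵥ (deriv P i 1 μ *ᵥ v)
        + c * (v ⬝ᵥ ((extMat P i i' e * avgMat P i i' e ((((P.L : ℝ) ^ P.d)⁻¹) ^ e)) *ᵥ v)) := by
    show v ⬝ᵥ (blockOp P i i' e m' c *ᵥ v) = _
    rw [blockOp, Matrix.add_mulVec, dotProduct_add, form_hOp, Matrix.smul_mulVec, dotProduct_smul,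
      smul_eq_mul]
  have hvv : ∑ p, v p ^ 2 = v ⬝ᵥ v := by simp only [dotProduct, sq]
  have hvv0 : 0 ≤ v ⬝ᵥ v := by rw [← hvv]; positivity
  rw [hform, hvv]
  have hL : (0 : ℝ) < ((P.L : ℝ) ^ e) ^ 2 := by have := P.cast_L_pos; positivity
  have h1 : γ * ((P.L : ℝ) ^ e) ^ 2 * (v ⬝ᵥ v) ≤ min 8 (c * ((P.L : ℝ) ^ e) ^ 2) * (v ⬝ᵥ v) :=
    mul_le_mul_of_nonneg_right hγ hvv0
  have h2 : ((P.L : ℝ) ^ e) ^ 2 * (γ * (v ⬝ᵥ v)) ≤ ((P.L : ℝ) ^ e) ^ 2 *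
      (∑ μ, (deriv P i 1 μ *ᵥ v) ⬝ᵥ (deriv P i 1 μ *ᵥ v)
        + c * (v ⬝ᵥ ((extMat P i i' e * avgMat P i i' e ((((P.L : ℝ) ^ P.d)⁻¹) ^ e)) *ᵥ v))) := by
    linarith
  have h3 := le_of_mul_le_mul_left h2 hL
  linarith [mul_nonneg hm hvv0]

/-- **(5.6) of [B4] for the block operator** on the torus `T^{(i)}` with the sup torus metric: symmetric, coercive
with `γ`, kernel bounded by `B·e^{R}·e^{−|x−x′|}`. [folklore] -/
theorem blockOp_hyp56 (hg : P.sitesPerDir i = P.L ^ e * P.sitesPerDir i') {m' c γ B R : ℝ} (hm : 0 ≤ m')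
    (hγ : γ * ((P.L : ℝ) ^ e) ^ 2 ≤ min 8 (c * ((P.L : ℝ) ^ e) ^ 2)) (hB : |m'| + 4 * P.d + |c| ≤ B)
    (hR2 : 2 ≤ R) (hRe : (P.L : ℝ) ^ e - 1 ≤ R) :
    B4Sect5Torus.Hyp56 (T P i) (blockOp P i i' e m' c) γ (B * Real.exp (1 * R)) 1 :=
  ⟨blockOp_isSymm i i' e m' c, fun v => blockOp_coercive hg hm hγ v, fun p q => blockOp_decay hg hB hR2 hRe p q⟩

/-- **Decay of the inverse** (finite Combes–Thomas, `B4Sect5Torus.inv_decay`, profile `K_d`):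
`|A⁻¹(x,x′)| ≤ (2/γ)·e^{−δ₁|x−x′|}`, `δ₁ = rate K_d γ (B e^R) 1 > 0`. [folklore] -/
theorem blockOp_inv_decay (hg : P.sitesPerDir i = P.L ^ e * P.sitesPerDir i') {m' c γ B R : ℝ} (hm : 0 ≤ m')
    (hγ0 : 0 < γ) (hγ : γ * ((P.L : ℝ) ^ e) ^ 2 ≤ min 8 (c * ((P.L : ℝ) ^ e) ^ 2)) (hB0 : 0 ≤ B)
    (hB : |m'| + 4 * P.d + |c| ≤ B) (hR2 : 2 ≤ R) (hRe : (P.L : ℝ) ^ e - 1 ≤ R) (x x' : Site P i) :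
    |(blockOp P i i' e m' c)⁻¹ x x'| ≤ 2 / γ *
      Real.exp (-(B4Sect5Torus.rate (B4Sect5Proof.latticeConst P.d) γ (B * Real.exp (1 * R)) 1 * T P i x x')) :=
  B4Sect5Torus.inv_decay (fun _ ha => B4Sect5Proof.latticeConst_nonneg P.d ha.le) hγ0 (by positivity) one_pos
    (T_isPseudoDist P i) (T_sumBound P i) (blockOp_hyp56 hg hm hγ hB hR2 hRe) x x'

end BlockOp

/-! ## §5 (2.37) at `j = 0` on the torus: the decay of `C^{(0)} = G0unit` and of `K0 = ∂¹_μ C^{(0)} ∂¹ᵀ_ν` -/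

section C0

variable (P : Params) {i : ℕ}

/-- `C^{(0)}` in lattice units IS the inverse of the block operator at `i = 0, i' = 1, e = lvl 1` with
`m′ = ε²m²`, `c = aL^{−2}`. [folklore] -/
theorem G0unit_eq (a msq : ℝ) :
    G0unit P a msq = (blockOp P 0 1 (lvl P 1) (P.eps ^ 2 * msq) (a * ((P.L : ℝ) ^ 2)⁻¹))⁻¹ := rfl

/-- The coercivity constant `γ₀ = min{8,a}/L²` of `C^{(0)}`'s operator. [folklore] -/
def gamma0 (L : ℕ) (a : ℝ) : ℝ := min 8 a / (L : ℝ) ^ 2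

/-- The (5.6) kernel constant `c₀ = (m² + 4d + a)·e^{L+1}` of `C^{(0)}`'s operator (rate `δ₀ = 1`). [folklore] -/
def c0 (d L : ℕ) (a msq : ℝ) : ℝ := (msq + 4 * d + a) * Real.exp (1 * ((L : ℝ) + 1))

/-- The decay rate `δ₁ = rate K_d γ₀ c₀ 1` of `C^{(0)}` and of `K0` — a function of `d, L, a, m²` only. [folklore] -/
def dK0 (d L : ℕ) (a msq : ℝ) : ℝ := B4Sect5Torus.rate (B4Sect5Proof.latticeConst d) (gamma0 L a) (c0 d L a msq) 1

/-- The constant `4·(2/γ₀)·e^{2δ₁}` of `K0` — a function of `d, L, a, m²` only. [folklore] -/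
def cK0 (d L : ℕ) (a msq : ℝ) : ℝ := 4 * (2 / gamma0 L a) * Real.exp (2 * dK0 d L a msq)

variable {P}

/-- `ε ≤ 1`. [folklore] -/
theorem eps_le_one : P.eps ≤ 1 :=
  pow_le_one₀ (inv_nonneg.mpr P.cast_L_pos.le) (inv_le_one_of_one_le₀ (one_lt_cast_L P).le)

/-- `γ₀ > 0` for `a > 0`. [folklore] -/
theorem gamma0_pos {a : ℝ} (ha : 0 < a) : 0 < gamma0 P.L a := by
  unfold gamma0
  have := P.cast_L_pos
  exact div_pos (lt_min (by norm_num) ha) (by positivity)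

/-- `γ₀(L^{lvl 1})² ≤ min{8, aL^{−2}(L^{lvl 1})²}` (both for `lvl 1 = 1` and the degenerate `lvl 1 = 0`). [folklore] -/
theorem gamma0_le {a : ℝ} (ha : 0 < a) :
    gamma0 P.L a * ((P.L : ℝ) ^ lvl P 1) ^ 2 ≤ min 8 (a * ((P.L : ℝ) ^ 2)⁻¹ * ((P.L : ℝ) ^ lvl P 1) ^ 2) := by
  have hL := P.cast_L_pos
  have hL1 : (1 : ℝ) ≤ (P.L : ℝ) ^ 2 := one_le_pow₀ (one_lt_cast_L P).le
  have hL2 : (0 : ℝ) < (P.L : ℝ) ^ 2 := by positivity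
  have hmin0 : 0 ≤ min 8 a := le_min (by norm_num) ha.le
  unfold gamma0
  rcases Nat.le_one_iff_eq_zero_or_eq_one.mp (show lvl P 1 ≤ 1 from min_le_left _ _) with h0 | h1
  · rw [h0, pow_zero, one_pow, mul_one, mul_one]
    refine le_min ?_ ?_
    · calc min 8 a / (P.L : ℝ) ^ 2 ≤ min 8 a := div_le_self hmin0 hL1
        _ ≤ 8 := min_le_left _ _
    · rw [div_eq_mul_inv]
      exact mul_le_mul_of_nonneg_right (min_le_right _ _) (inv_nonneg.mpr hL2.le)
  · rw [h1, pow_one, div_mul_cancel₀ _ hL2.ne', mul_assoc, inv_mul_cancel₀ hL2.ne', mul_one]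

/-- **(2.37) at j = 0 without derivatives, on the torus**: `|C^{(0)}(x,x′)| ≤ (2/γ₀)·e^{−δ₁|x−x′|}` in lattice units,
uniformly in the volume and the cutoff. [cite: Balaban1983RegularityDecay, (2.37) p.582] -/
theorem G0unit_decay {a msq : ℝ} (ha : 0 < a) (hm : 0 ≤ msq) (x x' : Site P 0) :
    |G0unit P a msq x x'| ≤ 2 / gamma0 P.L a * Real.exp (-(dK0 P.d P.L a msq * T P 0 x x')) := by
  have hL := P.cast_L_pos
  have hL1 : (1 : ℝ) ≤ (P.L : ℝ) := (one_lt_cast_L P).le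
  have hε := eps_le_one (P := P)
  have hε0 := P.eps_pos
  have hB : |P.eps ^ 2 * msq| + 4 * P.d + |a * ((P.L : ℝ) ^ 2)⁻¹| ≤ msq + 4 * P.d + a := by
    have h1 : |P.eps ^ 2 * msq| ≤ msq := by
      rw [abs_of_nonneg (by positivity)]
      calc P.eps ^ 2 * msq ≤ 1 * msq := mul_le_mul_of_nonneg_right (pow_le_one₀ hε0.le hε) hm
        _ = msq := one_mul _
    have h2 : |a * ((P.L : ℝ) ^ 2)⁻¹| ≤ a := by
      rw [abs_of_nonneg (by positivity)]
      calc a * ((P.L : ℝ) ^ 2)⁻¹ ≤ a * 1 :=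
            mul_le_mul_of_nonneg_left (inv_le_one_of_one_le₀ (one_le_pow₀ hL1)) ha.le
        _ = a := mul_one _
    linarith
  have hRe : (P.L : ℝ) ^ lvl P 1 - 1 ≤ (P.L : ℝ) + 1 := by
    have : (P.L : ℝ) ^ lvl P 1 ≤ (P.L : ℝ) ^ 1 := pow_le_pow_right₀ hL1 (min_le_left _ _)
    rw [pow_one] at this
    linarith
  rw [G0unit_eq]
  exact blockOp_inv_decay (sitesPerDir_zero_eq P 1) (by positivity) (gamma0_pos ha) (gamma0_le ha)
    (by positivity) hB (by linarith) hRe x x'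

/-- The kernel of a sandwich `∂¹_μ M ∂¹ᵀ_ν` is the mixed second difference of the kernel of `M`. [folklore] -/
theorem sandwich_apply (M : Matrix (Site P i) (Site P i) ℝ) (μ ν : Fin P.d) (x x' : Site P i) :
    (deriv P i 1 μ * M * (deriv P i 1 ν)ᵀ) x x'
      = (M (Site.shift x μ) (Site.shift x' ν) - M (Site.shift x μ) x') - (M x (Site.shift x' ν) - M x x') := by
  have hcol : ∀ y, (M * (deriv P i 1 ν)ᵀ) y x' = M y (Site.shift x' ν) - M y x' := by
    intro y
    have : (M * (deriv P i 1 ν)ᵀ) y x' = (deriv P i 1 ν *ᵥ (M y)) x' := by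
      simp only [Matrix.mul_apply, Matrix.transpose_apply, Matrix.mulVec, dotProduct]
      exact Finset.sum_congr rfl fun z _ => mul_comm _ _
    rw [this, deriv_mulVec, inv_one, one_mul]
  have hrow : (deriv P i 1 μ * M * (deriv P i 1 ν)ᵀ) x x'
      = (deriv P i 1 μ *ᵥ fun y => (M * (deriv P i 1 ν)ᵀ) y x') x := by
    rw [Matrix.mul_assoc]
    rfl
  rw [hrow, deriv_mulVec, inv_one, one_mul, hcol, hcol]

/-- Shifting either argument by a unit vector costs at most a factor `e^{δ}` in an `e^{−δ|x−x′|}` bound: if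
`|x − p| ≤ 1` and `|x′ − q| ≤ 1` then `e^{−δ|p−q|} ≤ e^{2δ}e^{−δ|x−x′|}`. [folklore] -/
theorem near_bound {M : Site P i → Site P i → ℝ} {C δ : ℝ} (hδ : 0 ≤ δ)
    (hM : ∀ p q, |M p q| ≤ C * Real.exp (-(δ * T P i p q))) {x x' p q : Site P i} (hp : T P i x p ≤ 1)
    (hq : T P i x' q ≤ 1) : |M p q| ≤ C * Real.exp (2 * δ) * Real.exp (-(δ * T P i x x')) := by
  have hC : 0 ≤ C := (mul_nonneg_iff_of_pos_right (Real.exp_pos _)).mp ((abs_nonneg _).trans (hM p q))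
  have ht : T P i x x' ≤ T P i p q + 2 := by
    have h1 := T_triangle P i x p x'
    have h2 := T_triangle P i p q x'
    rw [T_symm P i q x'] at h2
    linarith
  calc |M p q| ≤ C * Real.exp (-(δ * T P i p q)) := hM p q
    _ ≤ C * (Real.exp (2 * δ) * Real.exp (-(δ * T P i x x'))) := by
        apply mul_le_mul_of_nonneg_left _ hC
        rw [← Real.exp_add]
        exact Real.exp_le_exp.mpr (by nlinarith)
    _ = C * Real.exp (2 * δ) * Real.exp (-(δ * T P i x x')) := by ring

/-- `δ₁ > 0`. [folklore] -/
theorem dK0_pos {a msq : ℝ} (ha : 0 < a) (hm : 0 ≤ msq) : 0 < dK0 P.d P.L a msq := by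
  unfold dK0
  refine B4Sect5Torus.rate_pos (fun _ ha' => B4Sect5Proof.latticeConst_nonneg P.d ha'.le) (gamma0_pos ha) ?_ one_pos
  unfold c0
  positivity

/-- `cK0 ≥ 0`. [folklore] -/
theorem cK0_nonneg {a msq : ℝ} (ha : 0 < a) : 0 ≤ cK0 P.d P.L a msq := by
  unfold cK0
  have := gamma0_pos (P := P) ha
  positivity

/-- **(2.37) at j = 0 on the torus — the `K0` kernel of (1.136)**: for `a > 0`, `m² ≥ 0`,
`|(∂¹_μ C^{(0)} ∂¹ᵀ_ν)(x,x′)| ≤ cK0·e^{−dK0·|x−x′|}` on the whole unit torus `T^{(0)}` (sup torus metric, lattice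
units), with `cK0, dK0 > 0` depending on `d, L, a, m²` only. [cite: Balaban1983RegularityDecay, (2.37) p.582] -/
theorem K0_decay {a msq : ℝ} (ha : 0 < a) (hm : 0 ≤ msq) (μ ν : Fin P.d) (x x' : Site P 0) :
    |K0 P a msq μ ν x x'| ≤ cK0 P.d P.L a msq * Real.exp (-(dK0 P.d P.L a msq * T P 0 x x')) := by
  have hG : ∀ p q : Site P 0, |G0unit P a msq p q|
      ≤ 2 / gamma0 P.L a * Real.exp (-(dK0 P.d P.L a msq * T P 0 p q)) := fun p q => G0unit_decay ha hm p q
  have hδ := (dK0_pos (P := P) ha hm).le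
  have h0 : T P 0 x x ≤ 1 := by rw [T_self]; norm_num
  have h0' : T P 0 x' x' ≤ 1 := by rw [T_self]; norm_num
  have hs := T_shift_le_one P x μ
  have hs' := T_shift_le_one P x' ν
  rw [K0_eq ha hm, sandwich_apply]
  have e1 := near_bound hδ hG hs hs'
  have e2 := near_bound hδ hG hs h0'
  have e3 := near_bound hδ hG h0 hs'
  have e4 := near_bound hδ hG h0 h0'
  have hsum := (abs_sub _ _).trans (add_le_add ((abs_sub _ _).trans (add_le_add e1 e2))
    ((abs_sub _ _).trans (add_le_add e3 e4)))
  calc |G0unit P a msq (Site.shift x μ) (Site.shift x' ν) - G0unit P a msq (Site.shift x μ) x'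
        - (G0unit P a msq x (Site.shift x' ν) - G0unit P a msq x x')|
      ≤ 4 * (2 / gamma0 P.L a * Real.exp (2 * dK0 P.d P.L a msq) *
          Real.exp (-(dK0 P.d P.L a msq * T P 0 x x'))) := by linarith
    _ = cK0 P.d P.L a msq * Real.exp (-(dK0 P.d P.L a msq * T P 0 x x')) := by unfold cK0; ring

end C0

/-! ## §6 The first conjunct of `B5Ineq137.Leaf235to237` for the concrete scalar torus tower -/

section Leaf

variable (P : Params) (S : B5.Setting)

/-- The `K0` conjunct of `B5Ineq137.Leaf235to237` — «|C^{(0)} with two derivatives| ≤ c₀e^{−δ₀′L^k|x−x′|}» in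
η-units — as a predicate of its own. [cite: Balaban1984PropagatorsI, (1.136)–(1.137) p.40] -/
def LeafK0 (D : B5Ineq137.ScaleData S) (L c₀ δ₀' : ℝ) : Prop :=
  ∀ (μ ν : D.Dir) (x x' : D.X), |D.K0 μ ν x x'| ≤ c₀ * Real.exp (-(δ₀' * (L ^ S.k * D.distX x x')))

/-- The remaining conjuncts (`K1`, `K2`, `K3` at the levels `1 ≤ j < k`) of `B5Ineq137.Leaf235to237`.
[cite: Balaban1984PropagatorsI, (1.136)–(1.137) p.40] -/
def LeafK123 (D : B5Ineq137.ScaleData S) (c₀ δ₀' : ℝ) : Prop :=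
  ∀ j : ℕ, 1 ≤ j → j < S.k →
    (∀ (μ : D.Dir) (x : D.X) (y : D.U), |D.K1 j μ x y| ≤ c₀ * Real.exp (-(δ₀' * D.dXU j x y))) ∧
    (∀ (y y' : D.U), |D.K2 j y y'| ≤ c₀ * Real.exp (-(δ₀' * D.dUU j y y'))) ∧
    (∀ (ν : D.Dir) (y : D.U) (x' : D.X), |D.K3 j ν y x'| ≤ c₀ * Real.exp (-(δ₀' * D.dXU j x' y)))

variable {P S}

/-- `Leaf235to237` IS the conjunction `LeafK0 ∧ LeafK123` (definitionally). [folklore] -/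
theorem leaf235to237_iff (D : B5Ineq137.ScaleData S) (L c₀ δ₀' : ℝ) :
    B5Ineq137.Leaf235to237 D L c₀ δ₀' ↔ LeafK0 S D L c₀ δ₀' ∧ LeafK123 S D c₀ δ₀' := Iff.rfl

/-- Monotonicity of `LeafK0` in the constants, for the concrete tower. [folklore] -/
theorem leafK0_mono {cube : Site P 0 → S.Site → Prop} {comp : S.Loc → Fin P.d → (Site P 0 → ℝ)} {a msq : ℝ}
    {c c' δ δ' : ℝ} (hc0 : 0 ≤ c) (hc : c ≤ c') (hδ : δ' ≤ δ)
    (h : LeafK0 S (scaleData P S (aux P S cube comp) a msq) P.L c δ) :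
    LeafK0 S (scaleData P S (aux P S cube comp) a msq) P.L c' δ' := by
  intro μ ν x x'
  have hx := h μ ν x x'
  have ht : 0 ≤ (P.L : ℝ) ^ S.k * (scaleData P S (aux P S cube comp) a msq).distX x x' := by
    show 0 ≤ (P.L : ℝ) ^ S.k * (((P.L : ℝ) ^ S.k)⁻¹ * T P 0 x x')
    rw [mul_inv_cancel_left₀ (pow_ne_zero _ P.cast_L_pos.ne')]; exact T_nonneg P 0 x x'
  exact decay_mono ht hc hc0 hδ hx

/-- **THE NODE.**  The first conjunct of `B5Ineq137.Leaf235to237 (scaleData P S (aux P S cube comp) a msq) P.L c₀ δ₀′`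
— [B4] (2.37) at `j = 0` with two lattice derivatives, the `C^{(0)}(η^{−1}x, η^{−1}x′)` term of [B5] (1.136) — PROVED
for Bałaban's concrete scalar torus tower with `c₀ = cK0 d L a m²`, `δ₀′ = dK0 d L a m²` (uniform in the volume `m`,
the cutoff `K`, the level `S.k`, the cube relation and the component map).
[cite: Balaban1984PropagatorsI, (1.137) p.40][cite: Balaban1983RegularityDecay, (2.37) p.582] -/
theorem leafK0_torus (cube : Site P 0 → S.Site → Prop) (comp : S.Loc → Fin P.d → (Site P 0 → ℝ)) {a msq : ℝ}
    (ha : 0 < a) (hm : 0 ≤ msq) :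
    LeafK0 S (scaleData P S (aux P S cube comp) a msq) P.L (cK0 P.d P.L a msq) (dK0 P.d P.L a msq) := by
  intro μ ν x x'
  show |K0 P a msq μ ν x x'| ≤
    cK0 P.d P.L a msq * Real.exp (-(dK0 P.d P.L a msq * ((P.L : ℝ) ^ S.k * (((P.L : ℝ) ^ S.k)⁻¹ * T P 0 x x'))))
  rw [mul_inv_cancel_left₀ (pow_ne_zero _ P.cast_L_pos.ne')]  -- `L^k·distX = T` (`Beta.SliceLegs.pow_mul_distX`)
  exact K0_decay ha hm μ ν x x'

/-- The same, spelled out as the literal first conjunct of `Leaf235to237`. [cite: Balaban1984PropagatorsI, (1.137) p.40] -/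
theorem leaf235to237_conj1 (cube : Site P 0 → S.Site → Prop) (comp : S.Loc → Fin P.d → (Site P 0 → ℝ))
    {a msq : ℝ} (ha : 0 < a) (hm : 0 ≤ msq) :
    ∀ (μ ν : (scaleData P S (aux P S cube comp) a msq).Dir) (x x' : (scaleData P S (aux P S cube comp) a msq).X),
      |(scaleData P S (aux P S cube comp) a msq).K0 μ ν x x'| ≤ cK0 P.d P.L a msq *
        Real.exp (-(dK0 P.d P.L a msq * ((P.L : ℝ) ^ S.k * (scaleData P S (aux P S cube comp) a msq).distX x x'))) :=
  leafK0_torus cube comp ha hm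

/-- ASSEMBLY GLUE for the later nodes: the leaf follows from this node's `K0` bound and any proof of the `K1/K2/K3`
conjuncts, after raising both to common constants. [folklore] -/
theorem leaf235to237_of_K123 (cube : Site P 0 → S.Site → Prop) (comp : S.Loc → Fin P.d → (Site P 0 → ℝ))
    {a msq c₀ δ₀' : ℝ} (ha : 0 < a) (hm : 0 ≤ msq) (hc : cK0 P.d P.L a msq ≤ c₀) (hδ : δ₀' ≤ dK0 P.d P.L a msq)
    (h123 : LeafK123 S (scaleData P S (aux P S cube comp) a msq) c₀ δ₀') :
    B5Ineq137.Leaf235to237 (scaleData P S (aux P S cube comp) a msq) P.L c₀ δ₀' :=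
  ⟨leafK0_mono (cK0_nonneg (P := P) ha) hc hδ (leafK0_torus cube comp ha hm), h123⟩

end Leaf


end

end B5Leaf237C0Torus

end Literature.MathematicalPhysics.QuantumFieldTheory.Balaban1983to89
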